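import Summits.ValiantsHypothesis.ValiantsHypothesis.Theorems.LacunarySymmetroidMatrixDescartesCensusAtomM4K4CF30
import Summits.ValiantsHypothesis.ValiantsHypothesis.Theorems.LacunarySymmetroidMatrixDescartesCensusAtomM4K5EB37
import Summits.ValiantsHypothesis.ValiantsHypothesis.Theorems.LacunarySymmetroidMatrixDescartesCensusAtomM4K6KC45

/-!
# `MatrixDescartes` census — MIXED JUNCTION ROWS at `m = 4` from the atom blocks (block words, one line each)

HONEST FRAMING.  Experiment cell `val-V1-extremal`, width seat val-v1x-eng-8 g3 (`mixgen.py`).  Each theorem below is a census LOWER bound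
`¬ PosRootLawAt 4 K (N − 1)` («some real symmetric `K`-letter `4 × 4` lacunary pencil has `N` distinct positive determinant roots»)
obtained from kernel-certified ATOM BLOCKS of this cell (files `…CensusAtom*`: alternation certificate + Sylvester forms of the end letters,
all checked by the kernel) by the tree's JUNCTION LAW for matching junction inertia (`Chain.chain_append`, `…ChainInertia` /
`…ChainBlocks`, seat val-sym-mdr-p1) — alternation counts ADD, letter counts add minus one per junction — plus trailing grafts
(`+4` per added letter, `Reflect.not_posRootLawAt_of_certificateT_add`).  `ʳ` = block reversed (`x ↦ 1/x`, `Reflect.block_reverse`),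
`⁻` = all letters negated (`blockNeg`).  No explicit chained pencil is ever written: the kernel checks each atom once and the words here
are bookkeeping.  Rows: (4,8) ≥ 67 [M4K4CF30 ▹ M4K5EB37⁻ʳ] (was 66); (4,11) ≥ 97 [M4K4CF30 ▹ M4K4CF30 ▹ M4K5EB37⁻ʳ] (was 91); (4,12) ≥ 105 [M4K4CF30 ▹ M4K4CF30 ▹ M4K6KC45⁻] (was 101); (4,13) ≥ 120 [M4K4CF30 ▹ M4K4CF30 ▹ M4K4CF30 ▹ M4K4CF30] (was 112).  CONSTRUCTION-FAMILY provenance (junctions of flags/caps/towers found by the cell's engine seats —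
credits in the atom files).  Nothing here bears on the asymptotic crux `Theses.LacunarySymmetroid.MatrixDescartes`
(stmt-ValiantsHypothesis-18050) nor on `VP ≠ VNP`; VP ≠ VNP is NOT proved.  Generated 2026-08-29T03:13Z.  [folklore]
-/

-- `Summit.ValiantsHypothesis.ValiantsHypothesis.…` repeats a component by the D-0017 layout
-- (single-conjunct summit), which the `dupNamespace` linter flags; the name is mandated.
set_option linter.dupNamespace false

namespace Summit.ValiantsHypothesis.ValiantsHypothesis.Theorems.LacunarySymmetroidMatrixDescartes.Census.Reflect.MixM4

open Summit.ValiantsHypothesis.ValiantsHypothesis.Theorems.MatrixDescartes.Negative (PosRootLawAt)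
open Summit.ValiantsHypothesis.ValiantsHypothesis.Theorems.LacunarySymmetroidMatrixDescartes.Census
open Summit.ValiantsHypothesis.ValiantsHypothesis.Theorems.LacunarySymmetroidMatrixDescartes.Census.Reflect

/-- **`ζ_sym(4,8) ≥ 67`** (`¬ PosRootLawAt 4 8 66`) — the block word `M4K4CF30 ▹ M4K5EB37⁻ʳ` = `30 + 37` alternations on
`4 + 5 − 1` letters (junction law for matching junction inertia; kernel value before this file: 66). CAPF30 (val-v1x-eng-1, end inertia (3,1)) ▹ ENDBOTH37 (val-v1x-eng-2 g2) reversed and negated (its (1,3) top letter becomes a (3,1) bottom letter). [folklore] -/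
theorem mix_4_8 : ¬ PosRootLawAt 4 8 66 := by
  have h := Chain.not_posRootLawAt_of_certificateT (by norm_num)
      (Chain.chain_append (by norm_num) (Chain.chain_of_block Reflect.AtomM4K4CF30.block)
        (block_reverse Reflect.AtomM4K5EB37.blockNeg) (Equiv.refl (Fin 4)) (by intro i; fin_cases i <;> norm_num))
  norm_num at h
  exact h

/-- **`ζ_sym(4,11) ≥ 97`** (`¬ PosRootLawAt 4 11 96`) — the block word `M4K4CF30 ▹ M4K4CF30 ▹ M4K5EB37⁻ʳ` = `30 + 30 + 37` alternations on
`4 + 4 + 5 − 2` letters (junction law for matching junction inertia; kernel value before this file: 91). [folklore] -/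
theorem mix_4_11 : ¬ PosRootLawAt 4 11 96 := by
  have h := Chain.not_posRootLawAt_of_certificateT (by norm_num)
      (Chain.chain_append (by norm_num) (Chain.chain_append (by norm_num) (Chain.chain_of_block Reflect.AtomM4K4CF30.block)
        Reflect.AtomM4K4CF30.block (Equiv.refl (Fin 4)) (by intro i; fin_cases i <;> norm_num))
        (block_reverse Reflect.AtomM4K5EB37.blockNeg) (Equiv.refl (Fin 4)) (by intro i; fin_cases i <;> norm_num))
  norm_num at h
  exact h

/-- **`ζ_sym(4,12) ≥ 105`** (`¬ PosRootLawAt 4 12 104`) — the block word `M4K4CF30 ▹ M4K4CF30 ▹ M4K6KC45⁻` = `30 + 30 + 45` alternations on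
`4 + 4 + 6 − 2` letters (junction law for matching junction inertia; kernel value before this file: 101). … ▹ KCAP45 (val-v1x-eng-9 g2, (1,3) bottom letter) negated. [folklore] -/
theorem mix_4_12 : ¬ PosRootLawAt 4 12 104 := by
  have h := Chain.not_posRootLawAt_of_certificateT (by norm_num)
      (Chain.chain_append (by norm_num) (Chain.chain_append (by norm_num) (Chain.chain_of_block Reflect.AtomM4K4CF30.block)
        Reflect.AtomM4K4CF30.block (Equiv.refl (Fin 4)) (by intro i; fin_cases i <;> norm_num))
        Reflect.AtomM4K6KC45.blockNeg (Equiv.refl (Fin 4)) (by intro i; fin_cases i <;> norm_num))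
  norm_num at h
  exact h

/-- **`ζ_sym(4,13) ≥ 120`** (`¬ PosRootLawAt 4 13 119`) — the block word `M4K4CF30 ▹ M4K4CF30 ▹ M4K4CF30 ▹ M4K4CF30` = `30 + 30 + 30 + 30` alternations on
`4 + 4 + 4 + 4 − 3` letters (junction law for matching junction inertia; kernel value before this file: 112). [folklore] -/
theorem mix_4_13 : ¬ PosRootLawAt 4 13 119 := by
  have h := Chain.not_posRootLawAt_of_certificateT (by norm_num)
      (Chain.chain_append (by norm_num) (Chain.chain_append (by norm_num) (Chain.chain_append (by norm_num) (Chain.chain_of_block Reflect.AtomM4K4CF30.block)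
        Reflect.AtomM4K4CF30.block (Equiv.refl (Fin 4)) (by intro i; fin_cases i <;> norm_num))
        Reflect.AtomM4K4CF30.block (Equiv.refl (Fin 4)) (by intro i; fin_cases i <;> norm_num))
        Reflect.AtomM4K4CF30.block (Equiv.refl (Fin 4)) (by intro i; fin_cases i <;> norm_num))
  norm_num at h
  exact h

end Summit.ValiantsHypothesis.ValiantsHypothesis.Theorems.LacunarySymmetroidMatrixDescartes.Census.Reflect.MixM4
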